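import Summits.ResolutionOfSingularities.ResolutionOfSingularities.Theorems.AbhyankarShadowsShadowsUniformizeCompositeResidueDiscrete
import Summits.ResolutionOfSingularities.ResolutionOfSingularities.Theorems.AbhyankarShadowsShadowsUniformizeLurelDenseAbhyankar
import Literature.AlgebraicGeometry.Resolution.CompositeValuations
import HarnessLib

/-!
# The residue side of a composite valuation, dense-Abhyankar case (`stub_composite_residue_dense`)

Stub of the birth line of the crux `ShadowsUniformize` (stmt-ResolutionOfSingularities-16756, route
`AbhyankarShadows`), composite-uniformizable branch (lead c3). In the Novacoski–Spivakovsky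
decomposition `ν = ν₁ ∘ ν₂` of a valuation ring `O` of a function field `K/k` (`k` algebraically
closed of characteristic `p`) along a coarsening `O ≤ O₁`, the residue valuation `ν₂` has
valuation ring `O₂ := O / m_{O₁} = residueValuationSubring O O₁ hO` inside the residue field
`κ(O₁)`. The composition lemma hands over an abstract field `κ` with a `k`-algebra structure and a
`k`-compatible SURJECTIVE (hence bijective) homomorphism `ι : κ → κ(O₁)`, and asks for relative
local uniformization of the valuation ring `O₂' := ι⁻¹(O₂)` of `κ` over `k`.

When `O₂'` lies in the DENSE-ABHYANKAR locus of `κ/k` — there is a finitely generated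
intermediate field `κ₀` on which `O₂'` is an Abhyankar place over `k` and over which `κ` is dense
(Kuhlmann's places "very close to Abhyankar places") — this is the landed dense-Abhyankar branch
`lurelRational_of_isDenseAbhyankar` (Knaf–Kuhlmann 2009, Thm. 1.5 with `P|_K = id`,
`AbhyankarShadowsShadowsUniformizeLurelDenseAbhyankar.lean`) applied to `(κ, O₂')`; this file
checks its remaining hypotheses with the helpers of the discrete sibling
(`AbhyankarShadowsShadowsUniformizeCompositeResidueDiscrete.lean`):

* `fg_top_of_surjective` — `κ | k` is finitely generated: `κ(O₁)` is generated over `k` by the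
  residues of finitely many elements of `O` (hypothesis `hgen`), and `ι` is a bijection;
* `algebraMap_mem_comap_residueValuationSubring` — `k ⊆ O₂'`;
* `charP_of_injective_algebraMap` (Mathlib) — `char κ = p`, as `k ↪ κ`.

No rationality hypothesis and no named facts are used.

## Sources

* [KK09] H. Knaf, F.-V. Kuhlmann, *Every place admits local uniformization in a finite extension
  of the function field*, Adv. Math. 221 (2009) 428–453: Thm. 1.5. [KnafKuhlmann2009]
* [NS14] J. Novacoski, M. Spivakovsky, *Reduction of local uniformization to the rank one case*,
  2014: §2.1, Remark 2.4 (the decomposition `ν = ν₁ ∘ ν₂`). [NovacoskiSpivakovsky2014]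
-/

noncomputable section

-- single-problem summit: the doubled namespace component is forced
set_option linter.dupNamespace false

open Literature.AlgebraicGeometry.Resolution IsLocalRing

namespace Summit.ResolutionOfSingularities.ResolutionOfSingularities.Theorems

/-! ## The stub -/

/-- **STUB (c3; the residue side, dense-Abhyankar case).** For `k ⊆ O ≤ O₁` in `K` over the
algebraically closed `k` of characteristic `p`, `κ(O₁)` generated over `k` by residues of finitely
many elements of `O`, and any `k`-compatible surjective (hence bijective) `ι : κ → κ(O₁)`: if the
valuation ring `ι⁻¹(O / m_{O₁})` of `κ` lies in the dense-Abhyankar locus of `κ/k` (unfolded: an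
Abhyankar place on some finitely generated `κ₀`, with `κ` dense over `κ₀`), then it admits relative
local uniformization over `k` — `κ/k` is finitely generated (`fg_top_of_surjective`), `ι⁻¹(O₂)`
contains `k` (`algebraMap_mem_comap_residueValuationSubring`), `char κ = p`
(`charP_of_injective_algebraMap`), so `lurelRational_of_isDenseAbhyankar` (landed, c2) applies.
[cite: KnafKuhlmann2009, Thm. 1.5] -/
theorem stub_composite_residue_dense (p : ℕ) (hp : p.Prime) (k K : Type) [Field k] [CharP k p]
    [IsAlgClosed k] [Field K] [Algebra k K] (O O₁ : ValuationSubring K) (hO : O ≤ O₁)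
    (hk : ∀ c : k, algebraMap k K c ∈ O)
    (hgen : ∃ S : Finset O, ∀ T : Subfield (IsLocalRing.ResidueField O₁),
      (∀ c : k, IsLocalRing.residue O₁ ⟨algebraMap k K c, hO (hk c)⟩ ∈ T) →
      (∀ s ∈ S, IsLocalRing.residue O₁ ⟨(s : K), hO s.2⟩ ∈ T) → T = ⊤)
    (κ : Type) [Field κ] [Algebra k κ] (ι : κ →+* IsLocalRing.ResidueField O₁)
    (hι : Function.Surjective ι)
    (hιk : ∀ c : k, ι (algebraMap k κ c) = IsLocalRing.residue O₁ ⟨algebraMap k K c, hO (hk c)⟩)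
    (hD : ∃ κ₀ : IntermediateField k κ, κ₀.FG ∧
      IsAbhyankarPlace ((residueValuationSubring O O₁ hO).comap ι)
        (algebraMap k κ).fieldRange κ₀.toSubfield ∧
      IsDenseIn ((residueValuationSubring O O₁ hO).comap ι) κ₀.toSubfield ⊤)
    (R : Subalgebra k κ) (hR : R.FG)
    (hRO : R.toSubring ≤ ((residueValuationSubring O O₁ hO).comap ι).toSubring) :
    ∃ (B : Subalgebra k κ) (hB : B.toSubring ≤ ((residueValuationSubring O O₁ hO).comap ι).toSubring),
      R ≤ B ∧ B.FG ∧ IsRegularLocalRing (Localization.AtPrime (Ideal.comap (Subring.inclusion hB)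
        (IsLocalRing.maximalIdeal ((residueValuationSubring O O₁ hO).comap ι)))) := by
  classical
  -- (i) `κ | k` is finitely generated
  obtain ⟨S, hS⟩ := hgen
  have hfg : (⊤ : IntermediateField k κ).FG :=
    fg_top_of_surjective ι hι S (fun s : O => residue O₁ ⟨(s : K), hO s.2⟩)
      (fun T h₁ h₂ => hS T (fun c => by rw [← hιk]; exact h₁ c) h₂)
  -- (ii) constants
  have hk' : ∀ c : k, algebraMap k κ c ∈ (residueValuationSubring O O₁ hO).comap ι :=
    algebraMap_mem_comap_residueValuationSubring O O₁ hO hk ι hιk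
  -- (iii) characteristic
  haveI : CharP κ p := charP_of_injective_algebraMap (algebraMap k κ).injective p
  -- (iv) the dense-Abhyankar branch on `κ`
  obtain ⟨B, hB, hRB, hBfg, -, hreg⟩ :=
    lurelRational_of_isDenseAbhyankar p hp k κ hfg _ hk' hD R hR hRO
  exact ⟨B, hB, hRB, hBfg, hreg⟩

end Summit.ResolutionOfSingularities.ResolutionOfSingularities.Theorems

end
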